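import Mathlib
import Summits.KontsevichZagierPeriods.Zeta5Search.Elimination.SecondShell
import Summits.KontsevichZagierPeriods.Zeta5Search.SymRayBasics
import HarnessLib

/-!
# ζ(5) search — class `elim`: the second shell ON BROWN–ZUDILIN'S SYMMETRIC RAY, and the `ℚ`-span reading
# (cell `pub-zeta5`, fam-elim, E-L14; companion of E-L13 `Elimination/SecondShell.lean`)

HONEST FRAMING: systematic search; no irrationality claim unless certified.

OUR work (Summit side; `families/elim/FAMILY.md` §17.11).  E-L13 proved, for `b` in the box with `d(b) ≥ 1` and
admissible slots, the second-shell expansion `v(b + e_{i+1} + e_{j+1}) = v(b⁺⁺) + A_{ij}·v(b⁺) + B_{ij}·v(b)` in the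
diagonal frame and the weighted identity
`W(b⁺)·E(b, b″) = (W(b⁺⁺) + A_{ij}W(b⁺))·partnerElim b j + W(b)·partnerElim b⁺ j` for the `ζ(3)`-eliminant
`E(b, b″) = W(b″)F̃₇(b) − W(b)F̃₇(b″)` of the pair `(b, b″ = b + e_{i+1} + e_{j+1})` (and its stride-two analogue for
`b″ = b⁺⁺`).  This file records two readings:

* `strideTwo_elim_eq_div`, `secondShell_elim_eq_div` — **division form**: when `W(b⁺) ≠ 0` these eliminants lie in the
  `ℚ`-span of Brown–Zudilin's two-term forms `partnerElim b j = Q_j(b)ζ(5) − P_j(b)` and `partnerElim b⁺ j`, with the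
  explicit rational weights `(W(b⁺⁺) + A_{ij}W(b⁺))/W(b⁺)` (resp. `W(b⁺⁺)/W(b⁺)`) and `W(b)/W(b⁺)`;
* `typeI_ray_second`, `ray_second_elim_eq` — **the symmetric ray**: on `b_n = (3n; n⁷)` (`SymRay.bRay`, the
  Brown–Zudilin ray of the cell), slots `i = j = 0`, `n ≥ 1`: the second partner `b_n + 2e₁ = (3n; n+2, n⁶)` — as a
  function literally `up (up (SymRay.bRay n) 0) 0`, which is by `rfl` the `bRay'' n` of `SymRaySecondPartner`
  (`Function.update (bRay' n) 1 (bRay' n 1 + 1)`) — satisfies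
  `v(b_n + 2e₁) = v(b_n⁺⁺) + 2(n+2)(2n+1)·v(b_n⁺) + 2n(n+1)(n+2)(2n+1)·v(b_n)`,
  `b_n⁺ = (3n+2; (n+1)⁷)`, `b_n⁺⁺ = (3n+4; (n+2)⁷)` (`ray_secA`, `ray_secB` compute the weights), and its eliminant with
  `b_n`, weighted by `W(b_n⁺)`, is `(W(b_n⁺⁺) + 2(n+2)(2n+1)W(b_n⁺))·partnerElim b_n 0 + W(b_n)·partnerElim b_n⁺ 0`.

What this is NOT.  `SymRaySecondPartner.ray_second_U/W/V` expands the same vector `v(b_n + 2e₁)` in the RAY frame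
`{b_n, b_{n+1}, b_{n+2}}` (step `(3; 1⁷)`, Gosper-certified coefficients `κ₂, α₂, β₂, γ₂`); the DIAGONAL frame used here
(step `(2; 1⁷)`, elementary over (DS)) is a different basis of the same `ℚ³`, and no comparison of the two relations is
made or needed.  Nothing here is a statement about sizes, denominators or irrationality; `W(b_n⁺) ≠ 0` is NOT proved here.
-/

noncomputable section

open Finset

namespace Summit.KontsevichZagierPeriods.Zeta5Search.Elimination

open Summit.KontsevichZagierPeriods.Zeta5Search.DualSeries (InBox)
open Summit.KontsevichZagierPeriods.Zeta5Search.WedgeDictionary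

/-! ### Division form: membership in the `ℚ`-span of two consecutive Brown–Zudilin eliminants -/

/-- Division form (`W(b⁺) ≠ 0`): the stride-two eliminant lies in the `ℚ`-span of Brown–Zudilin's eliminants at
`b` and `b⁺`, with the explicit rational weights `W(b⁺⁺)/W(b⁺)` and `W(b)/W(b⁺)`. -/
theorem strideTwo_elim_eq_div (b : ℕ → ℤ) (hb : InBox b) (hd : 1 ≤ dOf b) {j : ℕ} (hj : j ∈ range 7)
    (hlj : b (j + 1) ≤ b 0) (hW : coeffW (dsShift b) ≠ 0) :
    pairElim b (dsShift (dsShift b)) =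
      ((coeffW (dsShift (dsShift b)) / coeffW (dsShift b) : ℚ) : ℝ) * partnerElim b j +
        ((coeffW b / coeffW (dsShift b) : ℚ) : ℝ) * partnerElim (dsShift b) j := by
  have h := strideTwo_elim_eq b hb hd hj hlj
  have hW' : (coeffW (dsShift b) : ℝ) ≠ 0 := by exact_mod_cast hW
  push_cast
  field_simp
  linear_combination h

/-- Division form (`W(b⁺) ≠ 0`): every second-shell eliminant lies in the `ℚ`-span of Brown–Zudilin's eliminants at
`b` and `b⁺`, with the explicit rational weights `(W(b⁺⁺) + A_{ij}W(b⁺))/W(b⁺)` and `W(b)/W(b⁺)`. -/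
theorem secondShell_elim_eq_div (b : ℕ → ℤ) (hb : InBox b) (hd : 1 ≤ dOf b) {i j : ℕ} (hi : i ∈ range 7)
    (hj : j ∈ range 7) (hlj : b (j + 1) ≤ b 0) (hli : up b j (i + 1) ≤ b 0) (hW : coeffW (dsShift b) ≠ 0) :
    pairElim b (up (up b j) i) =
      (((coeffW (dsShift (dsShift b)) + secA b i j * coeffW (dsShift b)) / coeffW (dsShift b) : ℚ) : ℝ) *
          partnerElim b j +
        ((coeffW b / coeffW (dsShift b) : ℚ) : ℝ) * partnerElim (dsShift b) j := by
  have h := secondShell_elim_eq b hb hd hi hj hlj hli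
  have hW' : (coeffW (dsShift b) : ℝ) ≠ 0 := by exact_mod_cast hW
  push_cast
  field_simp
  linear_combination h

/-! ### On Brown–Zudilin's symmetric ray `b_n = (3n; n⁷)` -/

/-- The hypotheses of the second-shell theorems hold on the symmetric ray `b_n = (3n; n⁷)` (`SymRay.bRay`) in the
slots `i = j = 0` as soon as `n ≥ 1` (`d(b_n) = 2n`). -/
theorem ray_hyps (n : ℕ) (hn : 1 ≤ n) :
    InBox (SymRay.bRay n) ∧ 1 ≤ dOf (SymRay.bRay n) ∧ SymRay.bRay n (0 + 1) ≤ SymRay.bRay n 0 ∧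
      up (SymRay.bRay n) 0 (0 + 1) ≤ SymRay.bRay n 0 := by
  refine ⟨SymRay.inBox_bRay n, by rw [SymRay.dOf_bRay]; omega, ?_, ?_⟩
  · simp only [zero_add, SymRay.bRay_one, SymRay.bRay_zero]; omega
  · rw [up_self]; simp only [zero_add, SymRay.bRay_one, SymRay.bRay_zero]; omega

/-- On the ray the second-shell weights are `A₀₀(b_n) = 2(n+2)(2n+1)` … -/
theorem ray_secA (n : ℕ) : secA (SymRay.bRay n) 0 0 = 2 * ((n : ℚ) + 2) * (2 * n + 1) := by
  rw [secA_self]; simp only [zero_add, SymRay.bRay_one, SymRay.bRay_zero]; push_cast; ring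

/-- … and `B₀₀(b_n) = 2n(n+1)(n+2)(2n+1)`. -/
theorem ray_secB (n : ℕ) : secB (SymRay.bRay n) 0 0 = 2 * (n : ℚ) * (n + 1) * (n + 2) * (2 * n + 1) := by
  unfold secB; rw [dsLam_up_self]; unfold dsLam; simp only [zero_add, SymRay.bRay_one, SymRay.bRay_zero]
  push_cast; ring

/-- **The symmetric ray's second partner in the diagonal frame.**  On `b_n = (3n; n⁷)` the second partner
`b_n + 2e₁ = (3n; n+2, n⁶)` — as a function literally `up (up (SymRay.bRay n) 0) 0`, which is definitionally the
`bRay'' n` of `SymRaySecondPartner` — satisfies, for `n ≥ 1`,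
`v(b_n + 2e₁) = v(b_n⁺⁺) + 2(n+2)(2n+1)·v(b_n⁺) + 2n(n+1)(n+2)(2n+1)·v(b_n)` with `b_n⁺ = (3n+2; (n+1)⁷)`,
`b_n⁺⁺ = (3n+4; (n+2)⁷)`.  (The RAY frame `{b_n, b_{n+1}, b_{n+2}}`, step `(3; 1⁷)`, of `SymRaySecondPartner` is a
different three-term relation, resting on Gosper certificates; the two are not compared here.) -/
theorem typeI_ray_second (n : ℕ) (hn : 1 ≤ n) :
    typeI (up (up (SymRay.bRay n) 0) 0) =
      typeI (dsShift (dsShift (SymRay.bRay n))) + (2 * ((n : ℚ) + 2) * (2 * n + 1)) • typeI (dsShift (SymRay.bRay n)) +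
        (2 * (n : ℚ) * (n + 1) * (n + 2) * (2 * n + 1)) • typeI (SymRay.bRay n) := by
  obtain ⟨hb, hd, hlj, hli⟩ := ray_hyps n hn
  have h := typeI_up_up (SymRay.bRay n) hb hd (i := 0) (j := 0) (by simp) (by simp) hlj hli
  rwa [ray_secA, ray_secB] at h

/-- **The symmetric ray's second-partner eliminant is a fixed combination of Brown–Zudilin's at `b_n` and `b_n⁺`:**
`W(b_n⁺)·[W(b_n+2e₁)F̃₇(b_n) − W(b_n)F̃₇(b_n+2e₁)] = (W(b_n⁺⁺) + 2(n+2)(2n+1)·W(b_n⁺))·partnerElim b_n 0 + W(b_n)·partnerElim b_n⁺ 0`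
(`n ≥ 1`; `partnerElim b_n 0 = Q₀(b_n)ζ(5) − P₀(b_n)` is Brown–Zudilin's own two-term form on the ray, E-L10). -/
theorem ray_second_elim_eq (n : ℕ) (hn : 1 ≤ n) :
    (coeffW (dsShift (SymRay.bRay n)) : ℝ) * pairElim (SymRay.bRay n) (up (up (SymRay.bRay n) 0) 0) =
      ((coeffW (dsShift (dsShift (SymRay.bRay n))) : ℝ) +
            (2 * ((n : ℝ) + 2) * (2 * n + 1)) * coeffW (dsShift (SymRay.bRay n))) * partnerElim (SymRay.bRay n) 0 +
        (coeffW (SymRay.bRay n) : ℝ) * partnerElim (dsShift (SymRay.bRay n)) 0 := by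
  obtain ⟨hb, hd, hlj, hli⟩ := ray_hyps n hn
  have h := secondShell_elim_eq (SymRay.bRay n) hb hd (i := 0) (j := 0) (by simp) (by simp) hlj hli
  rw [ray_secA] at h
  push_cast at h
  linear_combination h

end Summit.KontsevichZagierPeriods.Zeta5Search.Elimination

end
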